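import Literature.AlgebraicGeometry.GroupSchemes.KernelIdealFlatQuotient
import Literature.AlgebraicGeometry.GroupSchemes.ImageIdealRecognitionByRank
import Literature.AlgebraicGeometry.GroupSchemes.ImageIdealSpecialFibre
import Literature.AlgebraicGeometry.GroupSchemes.CartierDualAnnihilatorFlat
import Literature.AlgebraicGeometry.GroupSchemes.LayerMapKernel
import HarnessLib

/-!
# The cokernel of `Γ(φ)` is flat when the kernel of `φ` is: images of finite flat group schemes over a local base ([EGA IV₂] 2.8.5; [Tate 1997] (3.7))

Topic `Literature/AlgebraicGeometry/GroupSchemes`; namespaces `Literature.RingTheory.Flat` (§1) and `Literature.AlgebraicGeometry.GroupSchemes.AffineGroupScheme`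
(§2–§3).  THEOREMS ONLY (no definition, no instance, no notation, no named fact, no `sorry`).  Cell `hodgecm-mathlib` (D-0151), programme P6 «MOD» (crux hLiu418 =
stmt-HodgeConjecture-24832, `--supports`, count-neutral): organ **(F-in) «THE IMAGE COKERNEL IS FLAT»** of the FLATNESS-INPUT road of line L2 ∕ socket `stub_DOWN`
(LA2-plan (g0) deal 2026-09-02T02:20:59Z to LA2-p04 (g0); B-p08 (g34) yield 02:21:08Z): the instance hypothesis
`[Module.Flat R (Γ(G₁) ⧸ im Γ(φ))]` of ★ (SP-img) `ImageIdealSpecialFibre.spI_ker_comap_pullback_map_eq` («IMAGES SPECIALISE», equality half, LA2-p02 p847722),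
DISCHARGED from the flatness of the KERNEL quotient `Γ(G₁) ⧸ J(φ)` — itself supplied by ★ `KernelIdealFlatQuotient` (B-p08 p847870, rank door) or ★
`LayerMapKernel` (LA2-p04 p847980, structural door: `Ker φ ≅ Ker ψ` for the layer map of an isogeny with kernel in the layer).  Sequel of ★
`KernelIdealFlatQuotient` (its §1 «free from the fibre-rank inequality» is the engine).  HC_CM is proved only modulo the printed citations until rung 0 closes;
this file is generic and changes no count.

THE MATHEMATICS.  `R` local, `R → κ` a field killing `𝔪`, `R ↪ K` a field; `φ : G₁ → G₂` a homomorphism of affine `R`-group schemes with `Γ(G₁)` finite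
free of rank `n` and `Γ(Ker φ) = Γ(G₁) ⧸ J(φ)` flat, hence free of some rank `m ≥ 1`.  On each fibre `S ∈ {K, κ}`: `Γ((G₁)_S) ⧸ J(φ_S) = S ⊗_R Γ(Ker φ)` has
dimension `m` (★ `finrank_quotient_map_ker_counit_pullback_eq`), and the IMAGE RANK identity over a field (★ LA2-p01 p847849
`finrank_quotient_ker_comap_mul_finrank_quotient_map_ker_counit`: `dim im Γ(φ_S) · dim Γ(Ker φ_S) = dim Γ((G₁)_S) = n`) pins `dim_S im Γ(φ_S) = n ∕ m`
INDEPENDENTLY OF THE FIBRE.  Since `S ⊗_R coker Γ(φ) = coker (S ⊗ Γ(φ)) = coker Γ(φ_S)` (right exactness + ★ naturality `algBaseChangeEquiv_comap_pullback_map`),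
`dim_S (S ⊗_R coker Γ(φ)) = n − n ∕ m` for both fibres, and ★ B-p08 `free_of_finrank_tensor_le` (Nakayama + the generic fibre) makes `coker Γ(φ) =
Γ(G₁) ⧸ im Γ(φ)` FREE, in particular flat.  ([EGAIV2] 2.8.5: the schematic image of `G₁ → G₂` is then flat and commutes with the generic fibre; [Tate1997] (3.7).)

## Contents
* §1 (`Literature.RingTheory.Flat`, Mathlib-only) `nonempty_baseChange_quotient_range_linearEquiv` (`(L ⊗ N) ⧸ im (L ⊗ f) ≃ L ⊗ (N ⧸ im f)`),
  **`finrank_baseChange_quotient_range_add`** (`dim_L (L ⊗ coker f) + dim_L im (L ⊗ f) = dim_L (L ⊗ N)`).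
* §2 (`…AffineGroupScheme`) `map_id_comap_eq_baseChange_apply`, **`finrank_range_comap_pullback_map`** (`dim_S im Γ(φ_S) = dim_S im (S ⊗ Γ(φ))`),
  `finrank_range_comap_mul_finrank_quotient_map_ker_counit` (field: `dim im Γ(φ) · dim (Γ(G₁) ⧸ J(φ)) = dim Γ(G₁)`),
  **`finrank_tensor_quotient_range_comap_eq`** (`dim_S (S ⊗ coker Γ(φ)) = n − n ∕ m` on every fibre).
* §3 HEADS **`free_quotient_range_comap_of_flat_quotient_map_ker_counit`**, **`flat_quotient_range_comap_of_flat_quotient_map_ker_counit`** (= the p847722 §3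
  instance), **`spI_ker_comap_pullback_map_eq_of_flat_quotient_map_ker_counit`** («IMAGES SPECIALISE, equality, from kernel flatness»), and the pin form
  **`flat_quotient_range_comap_of_pin`** (layer map of `ψ` with `Ker ψ ≤ A[𝔭]` flat, ★ `LayerMapKernel`).
* §5 (ED. 2) RANK PINS: **`finrank_quotient_map_ker_counit_pullback_eq_finrank`** (`dim_S (Γ((G₁)_S) ⧸ J(φ_S)) = rk_R (Γ(G₁) ⧸ J(φ))` on every fibre, kernel quotient
  flat), `finrank_quotient_map_ker_counit_pullback_eq_of_flat` (generic = special kernel order), `finrank_range_comap_pullback_map_eq_div` (image order `n ∕ m` on every fibre).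

## References
* [EGAIV2] A. Grothendieck, J. Dieudonné, *ÉGA* IV₂, Publ. Math. IHÉS 24 (1965), Prop. 2.8.5.
* [Tate1997FiniteFlatGroupSchemes] J. Tate, *Finite flat group schemes* (1997), (3.7) p. 146.
* [AtiyahMacdonald1969] M. F. Atiyah, I. G. Macdonald, *Introduction to Commutative Algebra* (1969), Prop. 2.8, Prop. 2.18 (right exactness of `⊗`).
* [Milne2017] J. S. Milne, *Algebraic Groups* (2017), Ch. 3 §b Prop. 3.15; Ch. 11 §b Prop. 11.10.
* [GortzWedhorn2023] U. Görtz, T. Wedhorn, *Algebraic Geometry II* (2023), §(27.2) (27.2.1) (pp. 606–607).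
-/

set_option autoImplicit false

-- Mathlib's `Over`/`Scheme` APIs are stated across semireducible wrappers (as in the ★ `GroupSchemes/*` files).
set_option backward.isDefEq.respectTransparency false

universe u

open CategoryTheory CategoryTheory.Limits AlgebraicGeometry MonoidalCategory CartesianMonoidalCategory TensorProduct Module

noncomputable section

/-! ## §1 Base change of a cokernel (right exactness), with dimensions -/

namespace Literature.RingTheory.Flat

section Cokernel

variable {R : Type u} [CommRing R] (L : Type u) {P N : Type u} [AddCommGroup P] [Module R P] [AddCommGroup N] [Module R N]

/-- **`(L ⊗_R N) ⧸ im (L ⊗ f) ≃ L ⊗_R (N ⧸ im f)`** — right exactness of `L ⊗_R −` on `P → N → N ⧸ im f → 0` (Mathlib `lTensor_exact`,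
`Function.Exact.linearEquivOfSurjective`; `f.baseChange L` is `lTensor L f` with its `L`-structure). [cite: AtiyahMacdonald1969, Prop. 2.18] -/
theorem nonempty_baseChange_quotient_range_linearEquiv [CommRing L] [Algebra R L] (f : P →ₗ[R] N) :
    Nonempty (((L ⊗[R] N) ⧸ LinearMap.range (f.baseChange L)) ≃ₗ[L] L ⊗[R] (N ⧸ LinearMap.range f)) := by
  have hex : Function.Exact (f.baseChange L) ((LinearMap.range f).mkQ.baseChange L) :=
    lTensor_exact L (LinearMap.exact_map_mkQ_range f) (Submodule.mkQ_surjective _)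
  exact ⟨hex.linearEquivOfSurjective (LinearMap.baseChange_surjective L (Submodule.mkQ_surjective _))⟩

/-- **`dim_L (L ⊗_R coker f) + dim_L im (L ⊗ f) = dim_L (L ⊗_R N)`** for `L` a field over `R` and `N` finite (rank–nullity on the previous isomorphism).
[cite: AtiyahMacdonald1969, Prop. 2.18] -/
theorem finrank_baseChange_quotient_range_add [Field L] [Algebra R L] [Module.Finite R N] (f : P →ₗ[R] N) :
    finrank L (L ⊗[R] (N ⧸ LinearMap.range f)) + finrank L (LinearMap.range (f.baseChange L)) = finrank L (L ⊗[R] N) := by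
  obtain ⟨e⟩ := nonempty_baseChange_quotient_range_linearEquiv L f
  rw [← e.finrank_eq]
  exact Submodule.finrank_quotient_add_finrank _

end Cokernel

end Literature.RingTheory.Flat

namespace Literature.AlgebraicGeometry.GroupSchemes

namespace AffineGroupScheme

open scoped MonObj CategoryTheory.Obj

open Literature.AlgebraicGeometry.Motives GroupSchemeKernel

/-! ## §2 The image rank is the same on every fibre -/

section ImageRank

variable {R : Type u} [CommRing R] {G₁ G₂ : SchemeOver R} [GrpObj G₁] [GrpObj G₂] [IsAffine G₁.left] [IsAffine G₂.left] (φ : G₁ ⟶ G₂)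

omit [GrpObj G₁] [GrpObj G₂] [IsAffine G₁.left] [IsAffine G₂.left] in
/-- `S ⊗ Γ(φ)` (Mathlib `Algebra.TensorProduct.map (AlgHom.id S S) Γ(φ)`) is the base change `Γ(φ).baseChange S` on elements. [cite: GortzWedhorn2023, §(27.2) (27.2.1) (pp. 606–607)] -/
theorem map_id_comap_eq_baseChange_apply (S : Type u) [CommRing S] [Algebra R S] (z : S ⊗[R] Alg G₂) :
    Algebra.TensorProduct.map (AlgHom.id S S) (Alg.comap φ) z = (Alg.comap φ).toLinearMap.baseChange S z := by
  induction z using TensorProduct.induction_on with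
  | zero => simp only [map_zero]
  | tmul s a => rfl
  | add x y hx hy => simp only [map_add, hx, hy]

/-- **`dim_S im Γ(φ_S) = dim_S im (S ⊗ Γ(φ))`**: the square `e_{G₁} ∘ Γ(φ_S) = (S ⊗ Γ(φ)) ∘ e_{G₂}` of ★ `algBaseChangeEquiv_comap_pullback_map` identifies the two images
along the linear isomorphism `e_{G₁}`. [cite: GortzWedhorn2023, §(27.2) (27.2.1) (pp. 606–607)] -/
theorem finrank_range_comap_pullback_map (S : Type u) [Field S] [Algebra R S]
    [IsAffine ((Over.pullback (Spec.map (CommRingCat.ofHom (algebraMap R S)))).obj G₁).left]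
    [IsAffine ((Over.pullback (Spec.map (CommRingCat.ofHom (algebraMap R S)))).obj G₂).left] :
    finrank S (LinearMap.range (Alg.comap ((Over.pullback (Spec.map (CommRingCat.ofHom (algebraMap R S)))).map φ)).toLinearMap) =
      finrank S (LinearMap.range ((Alg.comap φ).toLinearMap.baseChange S)) := by
  have hcomp : (algBaseChangeEquiv S G₁).toLinearEquiv.toLinearMap ∘ₗ
        (Alg.comap ((Over.pullback (Spec.map (CommRingCat.ofHom (algebraMap R S)))).map φ)).toLinearMap =
      ((Alg.comap φ).toLinearMap.baseChange S) ∘ₗ (algBaseChangeEquiv S G₂).toLinearEquiv.toLinearMap := by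
    apply LinearMap.ext
    intro y
    change algBaseChangeEquiv S G₁ (Alg.comap ((Over.pullback (Spec.map (CommRingCat.ofHom (algebraMap R S)))).map φ) y) =
      (Alg.comap φ).toLinearMap.baseChange S (algBaseChangeEquiv S G₂ y)
    rw [algBaseChangeEquiv_comap_pullback_map, map_id_comap_eq_baseChange_apply]
  have h2 : LinearMap.range (((Alg.comap φ).toLinearMap.baseChange S) ∘ₗ (algBaseChangeEquiv S G₂).toLinearEquiv.toLinearMap) =
      LinearMap.range ((Alg.comap φ).toLinearMap.baseChange S) :=
    LinearMap.range_comp_of_range_eq_top _ (LinearMap.range_eq_top.mpr (algBaseChangeEquiv S G₂).surjective)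
  rw [← h2, ← hcomp, LinearMap.range_comp, LinearEquiv.finrank_map_eq]

end ImageRank

section Field

variable {k : Type u} [Field k] {G₁ G₂ : SchemeOver k} [GrpObj G₁] [GrpObj G₂] [IsAffine G₁.left] [IsAffine G₂.left] (φ : G₁ ⟶ G₂) [IsMonHom φ]
  [Module.Finite k (Alg G₁)]

/-- **IMAGE RANK in `range` currency: `dim_k im Γ(φ) · dim_k (Γ(G₁) ⧸ J(φ)) = dim_k Γ(G₁)`** (★ p847849 `finrank_quotient_ker_comap_mul_finrank_quotient_map_ker_counit` +
the first isomorphism theorem `Γ(G₂) ⧸ ker Γ(φ) ≅ im Γ(φ)`). [cite: Milne2017, Ch. 11 §b Prop. 11.10; Ch. 3 §b Prop. 3.15] -/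
theorem finrank_range_comap_mul_finrank_quotient_map_ker_counit :
    finrank k (LinearMap.range (Alg.comap φ).toLinearMap) *
        finrank k (Alg G₁ ⧸ (RingHom.ker (Bialgebra.counitAlgHom k (Alg G₂))).map (Alg.comap φ)) =
      finrank k (Alg G₁) := by
  rw [← finrank_quotient_ker_comap_mul_finrank_quotient_map_ker_counit φ]
  congr 1
  have hker : LinearMap.ker (Alg.comap φ).toLinearMap = (RingHom.ker (Alg.comap φ) : Ideal (Alg G₂)).restrictScalars k := by
    ext a
    rfl
  rw [← (LinearMap.quotKerEquivRange (Alg.comap φ).toLinearMap).finrank_eq, Submodule.quotEquivOfEq _ _ hker |>.finrank_eq,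
    (Submodule.Quotient.restrictScalarsEquiv k (RingHom.ker (Alg.comap φ) : Ideal (Alg G₂))).finrank_eq]

end Field

/-! ## §3 The cokernel of `Γ(φ)` is free when `Γ(G₁) ⧸ J(φ)` is flat -/

section Cokernel

variable {R : Type u} [CommRing R] [IsLocalRing R] (K κ : Type u) [Field K] [Algebra R K] [Field κ] [Algebra R κ]
  {G₁ G₂ : SchemeOver R} [GrpObj G₁] [GrpObj G₂] [IsAffine G₁.left] [IsAffine G₂.left] (φ : G₁ ⟶ G₂)
  [IsAffine ((Over.pullback (Spec.map (CommRingCat.ofHom (algebraMap R K)))).obj G₁).left]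
  [IsAffine ((Over.pullback (Spec.map (CommRingCat.ofHom (algebraMap R κ)))).obj G₁).left]
  [IsAffine ((Over.pullback (Spec.map (CommRingCat.ofHom (algebraMap R K)))).obj G₂).left]
  [IsAffine ((Over.pullback (Spec.map (CommRingCat.ofHom (algebraMap R κ)))).obj G₂).left]

/-- **THE FIBRE DIMENSION OF THE COKERNEL: `dim_S (S ⊗_R (Γ(G₁) ⧸ im Γ(φ))) = n − n ∕ m`** for EVERY field `S` over the local ring `R` (`n = rk_R Γ(G₁)`,
`m = rk_R (Γ(G₁) ⧸ J(φ))`, `Γ(G₁)` finite free, `Γ(G₁) ⧸ J(φ)` flat hence free): §1 + §2 + the image-rank identity on the fibre `S` + ★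
`finrank_quotient_map_ker_counit_pullback_eq` + ★ `finrank_alg_pullback_obj`. [cite: EGAIV2, Prop. 2.8.5] [cite: Tate1997FiniteFlatGroupSchemes, (3.7) p. 146] -/
theorem finrank_tensor_quotient_range_comap_eq [IsMonHom φ] [Module.Finite R (Alg G₁)] [Module.Free R (Alg G₁)]
    [Module.Flat R (Alg G₁ ⧸ (RingHom.ker (Bialgebra.counitAlgHom R (Alg G₂))).map (Alg.comap φ))]
    (S : Type u) [Field S] [Algebra R S]
    [IsAffine ((Over.pullback (Spec.map (CommRingCat.ofHom (algebraMap R S)))).obj G₁).left]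
    [IsAffine ((Over.pullback (Spec.map (CommRingCat.ofHom (algebraMap R S)))).obj G₂).left] :
    finrank S (S ⊗[R] (Alg G₁ ⧸ LinearMap.range (Alg.comap φ).toLinearMap)) =
      finrank R (Alg G₁) - finrank R (Alg G₁) / finrank R (Alg G₁ ⧸ (RingHom.ker (Bialgebra.counitAlgHom R (Alg G₂))).map (Alg.comap φ)) := by
  -- abbreviations
  set J : Ideal (Alg G₁) := (RingHom.ker (Bialgebra.counitAlgHom R (Alg G₂))).map (Alg.comap φ) with hJ
  haveI : Module.Finite R (Alg G₁ ⧸ J) :=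
    Module.Finite.of_surjective (Ideal.Quotient.mkₐ R J).toLinearMap (Ideal.Quotient.mkₐ_surjective R J)
  haveI : Module.Free R (Alg G₁ ⧸ J) := Module.free_of_flat_of_isLocalRing
  haveI : Module.Finite S (Alg ((Over.pullback (Spec.map (CommRingCat.ofHom (algebraMap R S)))).obj G₁)) :=
    Module.Finite.equiv (algBaseChangeEquiv S G₁).symm.toLinearEquiv
  -- the fibre ranks: `Γ((G₁)_S)` has dimension `n`, `Γ((G₁)_S) ⧸ J(φ_S)` has dimension `m`
  have hn : finrank S (Alg ((Over.pullback (Spec.map (CommRingCat.ofHom (algebraMap R S)))).obj G₁)) = finrank R (Alg G₁) :=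
    finrank_alg_pullback_obj S (H := G₁)
  have hm : finrank S (Alg ((Over.pullback (Spec.map (CommRingCat.ofHom (algebraMap R S)))).obj G₁) ⧸
        (RingHom.ker (Bialgebra.counitAlgHom S (Alg ((Over.pullback (Spec.map (CommRingCat.ofHom (algebraMap R S)))).obj G₂)))).map
          (Alg.comap ((Over.pullback (Spec.map (CommRingCat.ofHom (algebraMap R S)))).map φ))) = finrank R (Alg G₁ ⧸ J) := by
    rw [finrank_quotient_map_ker_counit_pullback_eq φ S, hJ, Module.finrank_baseChange]
  -- `m ≥ 1`: `J(φ_S)` is a proper ideal of the nonzero finite-dimensional `Γ((G₁)_S)`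
  have hmpos : 0 < finrank R (Alg G₁ ⧸ J) := by
    rw [← hm]
    haveI := Ideal.Quotient.nontrivial_iff.mpr (map_ker_counit_comap_ne_top ((Over.pullback (Spec.map (CommRingCat.ofHom (algebraMap R S)))).map φ))
    haveI : Module.Finite S (Alg ((Over.pullback (Spec.map (CommRingCat.ofHom (algebraMap R S)))).obj G₁) ⧸
        (RingHom.ker (Bialgebra.counitAlgHom S (Alg ((Over.pullback (Spec.map (CommRingCat.ofHom (algebraMap R S)))).obj G₂)))).map
          (Alg.comap ((Over.pullback (Spec.map (CommRingCat.ofHom (algebraMap R S)))).map φ))) :=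
      Module.Finite.of_surjective (Ideal.Quotient.mkₐ S _).toLinearMap (Ideal.Quotient.mkₐ_surjective S _)
    exact Module.finrank_pos
  -- image rank on the fibre `S`: `i_S · m = n`
  have hprod := finrank_range_comap_mul_finrank_quotient_map_ker_counit ((Over.pullback (Spec.map (CommRingCat.ofHom (algebraMap R S)))).map φ)
  rw [hm, hn, finrank_range_comap_pullback_map φ S] at hprod
  -- cokernel on the fibre `S`: `c_S + i_S = n`
  have hsum := Literature.RingTheory.Flat.finrank_baseChange_quotient_range_add S (Alg.comap φ).toLinearMap
  rw [Module.finrank_baseChange (R := S) (S := R) (M' := Alg G₁)] at hsum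
  have hi : finrank R (Alg G₁) / finrank R (Alg G₁ ⧸ J) = finrank S (LinearMap.range ((Alg.comap φ).toLinearMap.baseChange S)) :=
    Nat.div_eq_of_eq_mul_left hmpos hprod.symm
  rw [hi]
  omega

/-- **HEAD — THE COKERNEL OF `Γ(φ)` IS FREE WHEN THE KERNEL QUOTIENT IS FLAT**: `R` local, `R → κ` a field killing `𝔪`, `R ↪ K` a field, `φ : G₁ → G₂` a homomorphism of
affine `R`-group schemes with `Γ(G₁)` finite free and `Γ(G₁) ⧸ J(φ)` (`= Γ(Ker φ)`) flat ⇒ `Γ(G₁) ⧸ im Γ(φ)` is FREE (★ B-p08 `free_of_finrank_tensor_le` on the two equal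
fibre dimensions `finrank_tensor_quotient_range_comap_eq`). [cite: EGAIV2, Prop. 2.8.5] [cite: Tate1997FiniteFlatGroupSchemes, (3.7) p. 146] [cite: AtiyahMacdonald1969, Prop. 2.8] -/
theorem free_quotient_range_comap_of_flat_quotient_map_ker_counit [IsMonHom φ] [Module.Finite R (Alg G₁)] [Module.Free R (Alg G₁)]
    [Module.Flat R (Alg G₁ ⧸ (RingHom.ker (Bialgebra.counitAlgHom R (Alg G₂))).map (Alg.comap φ))]
    (hκ : IsLocalRing.maximalIdeal R ≤ RingHom.ker (algebraMap R κ)) (hK : Function.Injective (algebraMap R K)) :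
    Module.Free R (Alg G₁ ⧸ LinearMap.range (Alg.comap φ).toLinearMap) := by
  haveI : Module.Finite R (Alg G₁ ⧸ LinearMap.range (Alg.comap φ).toLinearMap) := Module.Finite.quotient R _
  refine Literature.RingTheory.Flat.free_of_finrank_tensor_le K _ κ hκ hK (le_of_eq ?_)
  rw [finrank_tensor_quotient_range_comap_eq φ κ, finrank_tensor_quotient_range_comap_eq φ K]

/-- **HEAD — THE COKERNEL OF `Γ(φ)` IS FLAT WHEN THE KERNEL QUOTIENT IS FLAT** (the instance hypothesis `[Module.Flat R (Γ(G₁) ⧸ im Γ(φ))]` of ★ (SP-img)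
`spI_ker_comap_pullback_map_eq`, p847722 §3). [cite: EGAIV2, Prop. 2.8.5] [cite: Tate1997FiniteFlatGroupSchemes, (3.7) p. 146] -/
theorem flat_quotient_range_comap_of_flat_quotient_map_ker_counit [IsMonHom φ] [Module.Finite R (Alg G₁)] [Module.Free R (Alg G₁)]
    [Module.Flat R (Alg G₁ ⧸ (RingHom.ker (Bialgebra.counitAlgHom R (Alg G₂))).map (Alg.comap φ))]
    (hκ : IsLocalRing.maximalIdeal R ≤ RingHom.ker (algebraMap R κ)) (hK : Function.Injective (algebraMap R K)) :
    Module.Flat R (Alg G₁ ⧸ LinearMap.range (Alg.comap φ).toLinearMap) := by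
  haveI := free_quotient_range_comap_of_flat_quotient_map_ker_counit K κ φ hκ hK
  infer_instance

/-- **HEAD — IMAGES SPECIALISE (equality) FROM KERNEL FLATNESS**: `spI (ker Γ(φ_K)) = ker Γ(φ_κ)` — the special fibre of the closure of the generic image IS the
special image — for `Γ(G₁)` finite free, `Γ(G₁) ⧸ J(φ)` flat, `R` local with `R ↪ K`, `𝔪 ↦ 0` in `κ` (★ p847722 `spI_ker_comap_pullback_map_eq` with its cokernel
instance discharged above). [cite: EGAIV2, Prop. 2.8.5] [cite: Tate1997FiniteFlatGroupSchemes, (3.7) p. 146] -/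
theorem spI_ker_comap_pullback_map_eq_of_flat_quotient_map_ker_counit [IsMonHom φ] [Module.Finite R (Alg G₁)] [Module.Free R (Alg G₁)]
    [Module.Flat R (Alg G₁ ⧸ (RingHom.ker (Bialgebra.counitAlgHom R (Alg G₂))).map (Alg.comap φ))]
    (hκ : IsLocalRing.maximalIdeal R ≤ RingHom.ker (algebraMap R κ)) (hK : Function.Injective (algebraMap R K)) :
    spI K κ G₂ (RingHom.ker (Alg.comap ((Over.pullback (Spec.map (CommRingCat.ofHom (algebraMap R K)))).map φ)).toRingHom) =
      RingHom.ker (Alg.comap ((Over.pullback (Spec.map (CommRingCat.ofHom (algebraMap R κ)))).map φ)).toRingHom := by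
  haveI := flat_quotient_range_comap_of_flat_quotient_map_ker_counit K κ φ hκ hK
  exact spI_ker_comap_pullback_map_eq K κ φ hK

/-- **HEAD (rank door end to end) — IMAGES SPECIALISE FROM THE KERNEL-RANK INEQUALITY**: if `dim_κ Γ(Ker φ_κ) ≤ dim_K Γ(Ker φ_K)` (★ B-p08
`flat_quotient_map_ker_counit_of_finrank_le`), then both the kernel and the image of `φ` specialise. [cite: EGAIV2, Prop. 2.8.5] [cite: Tate1997FiniteFlatGroupSchemes, (3.7) p. 146] -/
theorem spI_ker_comap_pullback_map_eq_of_finrank_le [IsMonHom φ] [Module.Finite R (Alg G₁)] [Module.Free R (Alg G₁)]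
    (hκ : IsLocalRing.maximalIdeal R ≤ RingHom.ker (algebraMap R κ)) (hK : Function.Injective (algebraMap R K))
    (h : finrank κ (Alg ((Over.pullback (Spec.map (CommRingCat.ofHom (algebraMap R κ)))).obj G₁) ⧸
          (RingHom.ker (Bialgebra.counitAlgHom κ
              (Alg ((Over.pullback (Spec.map (CommRingCat.ofHom (algebraMap R κ)))).obj G₂)))).map
            (Alg.comap ((Over.pullback (Spec.map (CommRingCat.ofHom (algebraMap R κ)))).map φ))) ≤
        finrank K (Alg ((Over.pullback (Spec.map (CommRingCat.ofHom (algebraMap R K)))).obj G₁) ⧸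
          (RingHom.ker (Bialgebra.counitAlgHom K
              (Alg ((Over.pullback (Spec.map (CommRingCat.ofHom (algebraMap R K)))).obj G₂)))).map
            (Alg.comap ((Over.pullback (Spec.map (CommRingCat.ofHom (algebraMap R K)))).map φ)))) :
    spI K κ G₂ (RingHom.ker (Alg.comap ((Over.pullback (Spec.map (CommRingCat.ofHom (algebraMap R K)))).map φ)).toRingHom) =
      RingHom.ker (Alg.comap ((Over.pullback (Spec.map (CommRingCat.ofHom (algebraMap R κ)))).map φ)).toRingHom := by
  haveI := flat_quotient_map_ker_counit_of_finrank_le K κ φ hκ hK h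
  exact spI_ker_comap_pullback_map_eq_of_flat_quotient_map_ker_counit K κ φ hκ hK

end Cokernel

/-! ## §3b Pin form: the cokernel of the layer map of an isogeny with flat kernel in the layer is flat -/

section Pin

variable {R : Type u} [CommRing R] [IsLocalRing R] (K κ : Type u) [Field K] [Algebra R K] [Field κ] [Algebra R κ]

/-- **HEAD (structural door end to end) — THE COKERNEL OF THE LAYER MAP IS FLAT**: pins `ιA : A[𝔭] ↪ A` (mono, kernel-of-`𝔭` universal property), `ιB : B[𝔭] ↪ B`
(mono homomorphism), `ψ : A → B` with `Ker ψ` killed by `𝔭` and `Ker ψ → Spec R` flat, `φ` the layer map (`φ ≫ ιB = ιA ≫ ψ`, a homomorphism), `Γ(A[𝔭])` finite free: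
then `Γ(A[𝔭]) ⧸ im Γ(φ)` is flat (★ `LayerMapKernel.flat_quotient_map_ker_counit_of_pin` + `flat_quotient_range_comap_of_flat_quotient_map_ker_counit`) — so ★ (SP-img)
equality holds for the layer map of the quotient isogenies of (O1) `stub_SPEC`. [cite: Tate1997FiniteFlatGroupSchemes, (3.7) p. 146] [cite: EGAIV2, Prop. 2.8.5] -/
theorem flat_quotient_range_comap_of_pin {A B GA GB : SchemeOver R} [MonObj A] [GrpObj B] [GrpObj GA] [GrpObj GB] [IsAffine GA.left] [IsAffine GB.left]
    [IsAffine ((Over.pullback (Spec.map (CommRingCat.ofHom (algebraMap R K)))).obj GA).left]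
    [IsAffine ((Over.pullback (Spec.map (CommRingCat.ofHom (algebraMap R κ)))).obj GA).left]
    [IsAffine ((Over.pullback (Spec.map (CommRingCat.ofHom (algebraMap R K)))).obj GB).left]
    [IsAffine ((Over.pullback (Spec.map (CommRingCat.ofHom (algebraMap R κ)))).obj GB).left]
    [Module.Finite R (Alg GA)] [Module.Free R (Alg GA)]
    {O : Type*} {σ : Type*} [SetLike σ O] (𝔭 : σ) (α : O → (A ⟶ A))
    (ιA : GA ⟶ A) [Mono ιA] (ιB : GB ⟶ B) [IsMonHom ιB] [Mono ιB]
    (hkerA : ∀ ⦃T : SchemeOver R⦄ (t : T ⟶ A), (∀ a ∈ 𝔭, t ≫ α a = 1) ↔ ∃ s : T ⟶ GA, s ≫ ιA = t)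
    (ψ : A ⟶ B) {φ : GA ⟶ GB} [IsMonHom φ] (hφ : φ ≫ ιB = ιA ≫ ψ)
    (hψ : ∀ ⦃T : SchemeOver R⦄ (t : T ⟶ A), t ≫ ψ = 1 → ∀ a ∈ 𝔭, t ≫ α a = 1) [Flat (ker ψ).hom]
    (hκ : IsLocalRing.maximalIdeal R ≤ RingHom.ker (algebraMap R κ)) (hK : Function.Injective (algebraMap R K)) :
    Module.Flat R (Alg GA ⧸ LinearMap.range (Alg.comap φ).toLinearMap) := by
  haveI := LayerMapKernel.flat_quotient_map_ker_counit_of_pin 𝔭 α ιA ιB hkerA ψ hφ hψ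
  exact flat_quotient_range_comap_of_flat_quotient_map_ker_counit K κ φ hκ hK

end Pin

/-! ## §5 (ED. 2) The rank pins: the fibre dimension of `Γ((G₁)_S) ⧸ J(φ_S)` is the rank of the flat `Γ(G₁) ⧸ J(φ)`, on EVERY fibre -/

section RankPin

variable {R : Type u} [CommRing R] [IsLocalRing R] {G₁ G₂ : SchemeOver R} [GrpObj G₁] [GrpObj G₂] [IsAffine G₁.left] [IsAffine G₂.left] (φ : G₁ ⟶ G₂)

/-- **RANK PIN (ED. 2) — `dim_S (Γ((G₁)_S) ⧸ J(φ_S)) = rk_R (Γ(G₁) ⧸ J(φ))` FOR EVERY FIELD `S` OVER THE LOCAL `R`** when `Γ(G₁)` is finite and the kernel quotient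
`Γ(G₁) ⧸ J(φ) = Γ(Ker φ)` is FLAT (hence free): the `hJ : finrank (Alg (G₁)_κ ⧸ J(φ_κ)) = m` input of ★ (D6-rk) `eq_ker_appTop_of_le_of_finrank_eq` with the SAME `m` on the generic
and the special fibre (★ `finrank_quotient_map_ker_counit_pullback_eq` + Mathlib `Module.finrank_baseChange`).  With ★ `LayerMapKernelBlock.flat_quotient_map_ker_counit_of_block`
this is the pin «`|Ker (ψ̄|layer)| = q`» of (O1-D6). [cite: EGAIV2, Prop. 2.8.5] [cite: Tate1997FiniteFlatGroupSchemes, (3.7) p. 146] -/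
theorem finrank_quotient_map_ker_counit_pullback_eq_finrank [IsMonHom φ] [Module.Finite R (Alg G₁)]
    [Module.Flat R (Alg G₁ ⧸ (RingHom.ker (Bialgebra.counitAlgHom R (Alg G₂))).map (Alg.comap φ))]
    (S : Type u) [Field S] [Algebra R S]
    [IsAffine ((Over.pullback (Spec.map (CommRingCat.ofHom (algebraMap R S)))).obj G₁).left]
    [IsAffine ((Over.pullback (Spec.map (CommRingCat.ofHom (algebraMap R S)))).obj G₂).left] :
    finrank S (Alg ((Over.pullback (Spec.map (CommRingCat.ofHom (algebraMap R S)))).obj G₁) ⧸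
        (RingHom.ker (Bialgebra.counitAlgHom S (Alg ((Over.pullback (Spec.map (CommRingCat.ofHom (algebraMap R S)))).obj G₂)))).map
          (Alg.comap ((Over.pullback (Spec.map (CommRingCat.ofHom (algebraMap R S)))).map φ))) =
      finrank R (Alg G₁ ⧸ (RingHom.ker (Bialgebra.counitAlgHom R (Alg G₂))).map (Alg.comap φ)) := by
  haveI : Module.Finite R (Alg G₁ ⧸ (RingHom.ker (Bialgebra.counitAlgHom R (Alg G₂))).map (Alg.comap φ)) :=
    Module.Finite.of_surjective (Ideal.Quotient.mkₐ R _).toLinearMap (Ideal.Quotient.mkₐ_surjective R _)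
  haveI : Module.Free R (Alg G₁ ⧸ (RingHom.ker (Bialgebra.counitAlgHom R (Alg G₂))).map (Alg.comap φ)) := Module.free_of_flat_of_isLocalRing
  rw [finrank_quotient_map_ker_counit_pullback_eq φ S, Module.finrank_baseChange]

/-- **RANK PIN, two fibres: `dim_K Γ(Ker φ_K) = dim_κ Γ(Ker φ_κ)`** (kernel-quotient currency) when `Γ(G₁) ⧸ J(φ)` is flat — the generic and special kernels of `φ` have the
same order (the equality that ★ B-p08 `finrank_ker_generic_eq_special_of_finrank_le` derives from the inequality). [cite: Tate1997FiniteFlatGroupSchemes, (3.7) p. 146] [cite: EGAIV2, Prop. 2.8.5] -/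
theorem finrank_quotient_map_ker_counit_pullback_eq_of_flat [IsMonHom φ] [Module.Finite R (Alg G₁)]
    [Module.Flat R (Alg G₁ ⧸ (RingHom.ker (Bialgebra.counitAlgHom R (Alg G₂))).map (Alg.comap φ))]
    (K κ : Type u) [Field K] [Algebra R K] [Field κ] [Algebra R κ]
    [IsAffine ((Over.pullback (Spec.map (CommRingCat.ofHom (algebraMap R K)))).obj G₁).left]
    [IsAffine ((Over.pullback (Spec.map (CommRingCat.ofHom (algebraMap R κ)))).obj G₁).left]
    [IsAffine ((Over.pullback (Spec.map (CommRingCat.ofHom (algebraMap R K)))).obj G₂).left]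
    [IsAffine ((Over.pullback (Spec.map (CommRingCat.ofHom (algebraMap R κ)))).obj G₂).left] :
    finrank K (Alg ((Over.pullback (Spec.map (CommRingCat.ofHom (algebraMap R K)))).obj G₁) ⧸
        (RingHom.ker (Bialgebra.counitAlgHom K (Alg ((Over.pullback (Spec.map (CommRingCat.ofHom (algebraMap R K)))).obj G₂)))).map
          (Alg.comap ((Over.pullback (Spec.map (CommRingCat.ofHom (algebraMap R K)))).map φ))) =
      finrank κ (Alg ((Over.pullback (Spec.map (CommRingCat.ofHom (algebraMap R κ)))).obj G₁) ⧸
        (RingHom.ker (Bialgebra.counitAlgHom κ (Alg ((Over.pullback (Spec.map (CommRingCat.ofHom (algebraMap R κ)))).obj G₂)))).map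
          (Alg.comap ((Over.pullback (Spec.map (CommRingCat.ofHom (algebraMap R κ)))).map φ))) := by
  rw [finrank_quotient_map_ker_counit_pullback_eq_finrank φ K, finrank_quotient_map_ker_counit_pullback_eq_finrank φ κ]

/-- **IMAGE RANK PIN: `dim_S im Γ(φ_S) = rk_R Γ(G₁) ∕ rk_R (Γ(G₁) ⧸ J(φ))` ON EVERY FIBRE** (`Γ(G₁)` finite free, kernel quotient flat): the order of the image of `φ_S` is the
same on the generic and the special fibre (★ `finrank_range_comap_mul_finrank_quotient_map_ker_counit` on the fibre + the kernel pin). [cite: EGAIV2, Prop. 2.8.5]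
[cite: Tate1997FiniteFlatGroupSchemes, (3.7) p. 146] -/
theorem finrank_range_comap_pullback_map_eq_div [IsMonHom φ] [Module.Finite R (Alg G₁)] [Module.Free R (Alg G₁)]
    [Module.Flat R (Alg G₁ ⧸ (RingHom.ker (Bialgebra.counitAlgHom R (Alg G₂))).map (Alg.comap φ))]
    (S : Type u) [Field S] [Algebra R S]
    [IsAffine ((Over.pullback (Spec.map (CommRingCat.ofHom (algebraMap R S)))).obj G₁).left]
    [IsAffine ((Over.pullback (Spec.map (CommRingCat.ofHom (algebraMap R S)))).obj G₂).left] :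
    finrank S (LinearMap.range (Alg.comap ((Over.pullback (Spec.map (CommRingCat.ofHom (algebraMap R S)))).map φ)).toLinearMap) =
      finrank R (Alg G₁) / finrank R (Alg G₁ ⧸ (RingHom.ker (Bialgebra.counitAlgHom R (Alg G₂))).map (Alg.comap φ)) := by
  haveI : Module.Finite S (Alg ((Over.pullback (Spec.map (CommRingCat.ofHom (algebraMap R S)))).obj G₁)) :=
    Module.Finite.equiv (algBaseChangeEquiv S G₁).symm.toLinearEquiv
  have hn : finrank S (Alg ((Over.pullback (Spec.map (CommRingCat.ofHom (algebraMap R S)))).obj G₁)) = finrank R (Alg G₁) :=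
    finrank_alg_pullback_obj S (H := G₁)
  have hm := finrank_quotient_map_ker_counit_pullback_eq_finrank φ S
  -- `m ≥ 1` on the fibre
  have hmpos : 0 < finrank R (Alg G₁ ⧸ (RingHom.ker (Bialgebra.counitAlgHom R (Alg G₂))).map (Alg.comap φ)) := by
    rw [← hm]
    haveI := Ideal.Quotient.nontrivial_iff.mpr (map_ker_counit_comap_ne_top ((Over.pullback (Spec.map (CommRingCat.ofHom (algebraMap R S)))).map φ))
    haveI : Module.Finite S (Alg ((Over.pullback (Spec.map (CommRingCat.ofHom (algebraMap R S)))).obj G₁) ⧸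
        (RingHom.ker (Bialgebra.counitAlgHom S (Alg ((Over.pullback (Spec.map (CommRingCat.ofHom (algebraMap R S)))).obj G₂)))).map
          (Alg.comap ((Over.pullback (Spec.map (CommRingCat.ofHom (algebraMap R S)))).map φ))) :=
      Module.Finite.of_surjective (Ideal.Quotient.mkₐ S _).toLinearMap (Ideal.Quotient.mkₐ_surjective S _)
    exact Module.finrank_pos
  have hprod := finrank_range_comap_mul_finrank_quotient_map_ker_counit ((Over.pullback (Spec.map (CommRingCat.ofHom (algebraMap R S)))).map φ)
  rw [hm, hn] at hprod
  exact (Nat.div_eq_of_eq_mul_left hmpos hprod.symm).symm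

end RankPin

end AffineGroupScheme

end Literature.AlgebraicGeometry.GroupSchemes

end
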